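/-
Copyright (c) 2026 the pub-hodgecm-mathlib formalisation cell (harness21).  Prover seat hodgecm-mathlib-B-p14 (g32) — (R2) glue ∕ assembly heir, 2026-09-01.
«EP-LETTER-RAM»: the letter (R2) `RankOneEulerPoincareNonsplit` modulo its RAMIFIED residue alone.
-/
import Literature.NumberTheory.Rogawski1990.RankOneEulerPoincareNonsplitOfResidues      -- ★ (B-p14 g32) p843462: `rankOneEulerPoincareNonsplit_of_unramified_of_ramified`
import Literature.NumberTheory.Rogawski1990.RankOneEulerPoincareNonsplitUnramifiedAll   -- ★ (B-p04 g35) p843494: the body at EVERY unramified non-split `v`, hypothesis-free (type-blind tree road)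
import HarnessLib

/-!
# The rank-one Euler–Poincaré letter (R2) modulo its ramified residue

Topic `NumberTheory/Rogawski1990`, namespace `Literature.NumberTheory.Rogawski1990`.  ONE THEOREM: no definition, no named fact, no instance, no notation, no
`sorry`; kernel lane.  The ONE-RESIDUE JUNCTION of the (R2) Euler–Poincaré road for `stub_N6nsR2EP : RankOneEulerPoincareNonsplit` (crux H413, line «N6nsGerm»,
pen F0P2-p02 (g9); LEAD F0P3a-plan (g10) T9-8 (C); EP pen heir B-p04 (g35)): the body of the letter at every UNRAMIFIED non-split place (dyadic included) is the
tree theorem ★ B-p04 `exists_isLocSmooth_classOrbitalIntegral_eq_one_zero_of_unramified` — Kottwitz's Euler–Poincaré function on the tree of `U(1,1)`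
[Kottwitz1988, §2; Serre1980Trees, II.1.1] through the type-blind Lefschetz relation ★ A-p17 (T3)∕(T4), transitivity ★ F0P2-p02 (hA)(hB) ∕ ★ B-p04 (hI), finiteness ★ B-p04,
the inert instance ★ B-p08, the non-elliptic relation ★ B-p10, the glue and assembly ★ B-p14 — so by ★ `rankOneEulerPoincareNonsplit_of_unramified_of_ramified`
(at `ϖ := ι_w(ϖ_v)`, ★ `valued_toPlace_uniformizer`, ★ `galAdicCompletionMap_toPlace_self`) the letter follows from its body at the RAMIFIED non-split places alone:
**`rankOneEulerPoincareNonsplit_of_ramified (hram) : RankOneEulerPoincareNonsplit`**.  The residue `hram` is the letter's own per-place body with the place `w ∣ v`,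
`w̄ = w` in hand (A-p06 (g27)'s (R2-ram) road: tame `v ∤ 2` through ★ `exists_isLocSmooth_classOrbitalIntegral_eq_one_zero_of_vertexEdgeLevels`; wild `v ∣ 2` booked).
HONEST LABEL: HC_CM is proved only modulo the cell's remaining named inputs (hLiu418, h413) until rung 0 closes; this file is unconditional (its residue is a
hypothesis, not a `sorry`), and (R2) itself is a PRINTED theorem [Kottwitz1988, §2 Thm. 2].

## References
* [Kottwitz1988] R. E. Kottwitz, *Tamagawa numbers*, Ann. of Math. 127 (1988), 629–646, §2 Theorem 2.
* [Rogawski1990] J. D. Rogawski, *Automorphic Representations of Unitary Groups in Three Variables* (1990), §12.6 p. 174.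
* [Serre1980Trees] J.-P. Serre, *Trees* (1980), Ch. II §1.1.
-/

set_option autoImplicit false

noncomputable section

open scoped ValuativeRel Matrix MatrixGroups
open Matrix ValuativeRel NumberField IsDedekindDomain MulAction MeasureTheory Measure

namespace Literature.NumberTheory.Rogawski1990

open Literature.NumberTheory.Automorphic Literature.NumberTheory.Automorphic.UnitaryGroup Literature.NumberTheory.GaloisRepresentations

/-- **(R2) MODULO ITS RAMIFIED RESIDUE**: if the body of `RankOneEulerPoincareNonsplit` holds at every non-split `v` RAMIFIED in `L` (stated with the place
`w ∣ v`, `w̄ = w`, in hand), the letter holds — the unramified non-split places are ★ `exists_isLocSmooth_classOrbitalIntegral_eq_one_zero_of_unramified`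
(B-p04 (g35)) at the `σ_w`-fixed uniformiser `ι_w(ϖ_v)`. [cite: Kottwitz1988, §2 Theorem 2] [cite: Rogawski1990, §12.6 p. 174] [cite: Serre1980Trees, II.1.1] -/
theorem rankOneEulerPoincareNonsplit_of_ramified
    (hram : ∀ (L : Type) [Field L] [NumberField L] [IsCMField L] (v : HeightOneSpectrum (𝓞 ↥(maximalRealSubfield L)))
      (w : UnitaryGroup.PlacesOver L v) (hw : IsCMField.complexConj L • w.1 = w.1),
      ¬ Algebra.IsUnramifiedIn (𝓞 L) v.asIdeal →
      ∀ [MeasurableSpace ((UnitaryGroup.cmDatum L 2 (Matrix.of fun i j : Fin 2 => if i.val + j.val + 1 = 2 then (1 : L) else 0)).Local v)]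
        [BorelSpace ((UnitaryGroup.cmDatum L 2 (Matrix.of fun i j : Fin 2 => if i.val + j.val + 1 = 2 then (1 : L) else 0)).Local v)]
        (ν : Measure ((UnitaryGroup.cmDatum L 2 (Matrix.of fun i j : Fin 2 => if i.val + j.val + 1 = 2 then (1 : L) else 0)).Local v))
        [ν.IsHaarMeasure] [ν.IsMulRightInvariant]
        [_iZ : ∀ γ : (UnitaryGroup.cmDatum L 2 (Matrix.of fun i j : Fin 2 => if i.val + j.val + 1 = 2 then (1 : L) else 0)).Local v,
          MeasurableSpace (((UnitaryGroup.cmDatum L 2 (Matrix.of fun i j : Fin 2 => if i.val + j.val + 1 = 2 then (1 : L) else 0)).Local v) ⧸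
            Subgroup.centralizer ({γ} : Set ((UnitaryGroup.cmDatum L 2 (Matrix.of fun i j : Fin 2 => if i.val + j.val + 1 = 2 then (1 : L) else 0)).Local v)))]
        [_bZ : ∀ γ : (UnitaryGroup.cmDatum L 2 (Matrix.of fun i j : Fin 2 => if i.val + j.val + 1 = 2 then (1 : L) else 0)).Local v,
          BorelSpace (((UnitaryGroup.cmDatum L 2 (Matrix.of fun i j : Fin 2 => if i.val + j.val + 1 = 2 then (1 : L) else 0)).Local v) ⧸
            Subgroup.centralizer ({γ} : Set ((UnitaryGroup.cmDatum L 2 (Matrix.of fun i j : Fin 2 => if i.val + j.val + 1 = 2 then (1 : L) else 0)).Local v)))]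
        (m : OrbitalMeasureFamily ((UnitaryGroup.cmDatum L 2 (Matrix.of fun i j : Fin 2 => if i.val + j.val + 1 = 2 then (1 : L) else 0)).Local v)),
        m.IsCanonical (fun γ => IsRegularElt (γ.val : GL (Fin 2) (UnitaryGroup.LocalRing L v))) ν →
        ∃ f : (UnitaryGroup.cmDatum L 2 (Matrix.of fun i j : Fin 2 => if i.val + j.val + 1 = 2 then (1 : L) else 0)).Local v → ℂ, IsLocSmooth f ∧
          (∀ γ : (UnitaryGroup.cmDatum L 2 (Matrix.of fun i j : Fin 2 => if i.val + j.val + 1 = 2 then (1 : L) else 0)).Local v,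
              IsRegularElt (γ.val : GL (Fin 2) (UnitaryGroup.LocalRing L v)) →
              CompactSpace (Subgroup.centralizer ({γ} : Set ((UnitaryGroup.cmDatum L 2 (Matrix.of fun i j : Fin 2 => if i.val + j.val + 1 = 2 then (1 : L) else 0)).Local v))) →
              classOrbitalIntegral m f (ConjClasses.mk γ) = 1) ∧
          (∀ γ : (UnitaryGroup.cmDatum L 2 (Matrix.of fun i j : Fin 2 => if i.val + j.val + 1 = 2 then (1 : L) else 0)).Local v,
              IsRegularElt (γ.val : GL (Fin 2) (UnitaryGroup.LocalRing L v)) →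
              ¬ CompactSpace (Subgroup.centralizer ({γ} : Set ((UnitaryGroup.cmDatum L 2 (Matrix.of fun i j : Fin 2 => if i.val + j.val + 1 = 2 then (1 : L) else 0)).Local v))) →
              classOrbitalIntegral m f (ConjClasses.mk γ) = 0)) :
    RankOneEulerPoincareNonsplit := by
  refine rankOneEulerPoincareNonsplit_of_unramified_of_ramified (fun L _ _ _ v w hw hv => ?_) hram
  intro _ _ ν _ _ _ _ m hm
  exact exists_isLocSmooth_classOrbitalIntegral_eq_one_zero_of_unramified L w hw
    (Units.mk0 _ (toPlace_uniformizer_ne_zero L v w hv)) (valued_toPlace_uniformizer L v w hv)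
    (galAdicCompletionMap_toPlace_self L v w hw _) ν hv hm

end Literature.NumberTheory.Rogawski1990

end
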